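import Summits.PneNP.PneNP.Theorems.ReslinSizeFromWidthQuadraticDictionary

/-!
# PneNP / ReslinSizeFromWidth — quadratic size–width law, part 4b: the clause of a flat

Helper file for the quadratic truncation of crux `ResLinSizeFromWidth` (stmt-PneNP-18932).
For a flat `S` on the window, `clOf N S` is the linear clause whose literals are a basis of
`W S`: it has `≤ dim W S` literals, its forms lie in the window, and it is falsified exactly on `S`
(`falsN_clOf`); inclusion of a half `S ∩ hyp (eqOf l)` in a flat `P` becomes the semantic
implication `clOf P ⊨ insert l (clOf S)`.
-/

namespace Summit.PneNP.PneNP.Theorems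

-- `Summit.PneNP.PneNP` repeats a path component by design (summit = sub-problem); silence the linter.
set_option linter.dupNamespace false

namespace ResLinSW

section Bridge

open Module Submodule Finset
open Literature.Computability.Complexity Literature.Computability.MetaComplexity
open Literature.Computability.MetaComplexity.AffSys
open Summit.PneNP.PneNP.Theorems.ResLinRank

variable (N : Finset ℕ)

/-! ### From a semantic refutation to a Res(⊕) refutation -/

/-- The support of a form on the window, as a set of variables. -/
def suppOf (g : ↥N → ZMod 2) : Finset ℕ :=
  (Finset.univ.filter fun v : ↥N => g v = 1).map ⟨Subtype.val, Subtype.val_injective⟩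

/-- The support lies in the window. -/
theorem suppOf_subset (g : ↥N → ZMod 2) : suppOf N g ⊆ N := by
  intro x hx
  rw [suppOf, Finset.mem_map] at hx
  obtain ⟨v, -, rfl⟩ := hx
  exact v.2

/-- Restricting the form of the support recovers the form. -/
theorem restrictN_linFormVec_suppOf (g : ↥N → ZMod 2) : restrictN N (linFormVec (suppOf N g)) = g := by
  have h2 : ∀ a : ZMod 2, a = 0 ∨ a = 1 := by decide
  funext v
  simp only [restrictN, LinearMap.funLeft_apply, linFormVec_apply, suppOf, Finset.mem_map,
    Finset.mem_filter, Finset.mem_univ, true_and, Function.Embedding.coeFn_mk]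
  by_cases hv : g v = 1
  · rw [if_pos ⟨v, hv, rfl⟩, hv]
  · rw [if_neg]
    · rcases h2 (g v) with h | h
      · exact h.symm
      · exact absurd h hv
    · rintro ⟨w, hw, hwv⟩
      have : w = v := Subtype.ext hwv
      subst this
      exact hv hw

/-- The linear literal of an equation: `lit θ` is FALSE exactly on `hyp θ`. -/
def litOf (θ : Eqn ↥N) : LinLit := (suppOf N θ.1, decide (θ.2 = 0))

/-- `eqOf (litOf θ) = θ`. -/
theorem eqOf_litOf (θ : Eqn ↥N) : eqOf N (litOf N θ) = θ := by
  have h2 : ∀ a : ZMod 2, a = 0 ∨ a = 1 := by decide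
  ext1
  · simp [eqOf, litOf, restrictN_linFormVec_suppOf]
  · simp only [eqOf, litOf, decide_eq_true_eq]
    rcases h2 θ.2 with h | h <;> simp [h]

/-- The linear clause of a flat: the literals of a basis of its equations. -/
noncomputable def clOf (S : Set (↥N → ZMod 2)) : LinClause :=
  Finset.univ.image fun i => litOf N ((Module.finBasis (ZMod 2) ↥(W S) i : ↥(W S)) : Eqn ↥N)

/-- The clause of a flat has at most `dim W S` literals. -/
theorem card_clOf_le (S : Set (↥N → ZMod 2)) : (clOf N S).card ≤ finrank (ZMod 2) ↥(W S) := by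
  rw [clOf]
  exact Finset.card_image_le.trans (by simp)

/-- Forms of the clause of a flat lie inside the window. -/
theorem forms_clOf_subset (S : Set (↥N → ZMod 2)) : ∀ l ∈ clOf N S, l.1 ⊆ N := by
  intro l hl
  rw [clOf, Finset.mem_image] at hl
  obtain ⟨i, -, rfl⟩ := hl
  exact suppOf_subset N _

/-- Evaluation of an equation at a point, as a linear map (`θ ↦ ⟨θ.1, z⟩ + θ.2`; it vanishes iff
`z ∈ hyp θ`). -/
def evalPt (z : ↥N → ZMod 2) : Eqn ↥N →ₗ[ZMod 2] ZMod 2 where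
  toFun θ := θ.1 ⬝ᵥ z + θ.2
  map_add' θ η := by
    simp only [Prod.fst_add, Prod.snd_add, add_dotProduct]
    ring
  map_smul' c θ := by
    simp only [Prod.smul_fst, Prod.smul_snd, smul_dotProduct, smul_eq_mul, RingHom.id_apply]
    ring

/-- `evalPt z θ = 0 ↔ z ∈ hyp θ`. -/
theorem evalPt_eq_zero_iff (z : ↥N → ZMod 2) (θ : Eqn ↥N) : evalPt N z θ = 0 ↔ z ∈ hyp θ := by
  have h2 : ∀ a b : ZMod 2, a + b = 0 ↔ a = b := by decide
  simp only [evalPt, LinearMap.coe_mk, AddHom.coe_mk, mem_hyp]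
  exact h2 _ _

/-- **The clause of a flat falsifies exactly the flat**: `fals (clOf S) = S`. -/
theorem falsN_clOf {S : Set (↥N → ZMod 2)} (hS : IsFlat S) : falsN N (clOf N S) = S := by
  classical
  set b := Module.finBasis (ZMod 2) ↥(W S) with hb
  have hsys : negSys N (clOf N S) = Finset.univ.image fun i => ((b i : ↥(W S)) : Eqn ↥N) := by
    rw [negSys_eq_image, clOf, Finset.image_image]
    refine Finset.image_congr fun i _ => ?_
    simp [Function.comp, eqOf_litOf, hb]
  ext z
  rw [falsN, hsys, mem_Sol]
  simp only [Finset.mem_image, Finset.mem_univ, true_and, forall_exists_index,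
    forall_apply_eq_imp_iff]
  constructor
  · intro h
    refine hS.mem_of z fun θ hθ => ?_
    -- θ is a combination of the basis, and evalPt z kills the basis
    rw [← evalPt_eq_zero_iff]
    have hker : ∀ i, evalPt N z ((b i : ↥(W S)) : Eqn ↥N) = 0 := fun i =>
      (evalPt_eq_zero_iff N z _).2 (h i)
    have hzero : (evalPt N z).comp (W S).subtype = 0 :=
      b.ext fun i => by simpa using hker i
    have := LinearMap.congr_fun hzero ⟨θ, hθ⟩
    simpa using this
  · intro hz i
    exact (b i).2 z hz

/-- Semantic implication between clauses of flats from inclusion, with an extra literal: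
if `S ∩ hyp (eqOf l) ⊆ P` then `clOf P ⊨ insert l (clOf S)`. -/
theorem imp_insert_clOf {S P : Set (↥N → ZMod 2)} (hS : IsFlat S) (hP : IsFlat P) (l : LinLit)
    (hl : l.1 ⊆ N) (h : S ∩ hyp (eqOf N l) ⊆ P) :
    ∀ σ : ℕ → Bool, (clOf N P).eval σ = true → (insert l (clOf N S)).eval σ = true := by
  intro σ hσ
  by_contra hcon
  rw [Bool.not_eq_true] at hcon
  have hforms : ∀ l' ∈ insert l (clOf N S), l'.1 ⊆ N := by
    intro l' hl'
    rcases Finset.mem_insert.1 hl' with rfl | hl'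
    · exact hl
    · exact forms_clOf_subset N S l' hl'
  have hz := (zOf_mem_Sol_negSys_iff hforms σ).2 hcon
  have hz' : zOf N σ ∈ falsN N (insert l (clOf N S)) := hz
  rw [falsN_insert, falsN_clOf N hS] at hz'
  have hzP : zOf N σ ∈ P := h ⟨hz'.2, hz'.1⟩
  rw [← falsN_clOf N hP] at hzP
  have := (zOf_mem_Sol_negSys_iff (forms_clOf_subset N P) σ).1 hzP
  rw [hσ] at this
  exact Bool.noConfusion this

end Bridge

end ResLinSW

end Summit.PneNP.PneNP.Theorems
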